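import Mathlib
import HarnessLib
import Literature.MathematicalPhysics.QuantumFieldTheory.MassGapFromLatticeClustering
import Literature.MathematicalPhysics.QuantumLattice.SchwingerGrowthTwoFactor
import Summits.QuantumFields.YangMills.Theorems.ConvexGribovBodyContinuumLegGivenGapStubArp
import Summits.QuantumFields.YangMills.Theorems.ParabolicTrajectoryContinuumLimitOnTrajectoryStubOSLegsA_Lattice
import Summits.QuantumFields.YangMills.Theorems.ParabolicTrajectoryContinuumLimitOnTrajectoryStubTransl
import Summits.QuantumFields.YangMills.Theorems.ParabolicTrajectoryLatticeGapOnTrajectoryTransferReduction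

/-!
# `ContinuumLegGivenGap` (stmt-QuantumFields-15828), line `Sketch` (reshape 14): (CL-t) from (CSCL) — `stub_cltOfCscl`

Support file for the crux item stmt-QuantumFields-15828 (registered glue stub `stub_cltOfCscl` of line `Sketch`,
reshape 14). The UV stub of the line delivers, for a canonically normalised ((CAN) `c_k = a_k⁻⁴`), exactly centred
((VS)) scheme, the uniform-threshold plaquette-string bounds (UUVB), polynomial volume growth (PVG) and (CSCL) =
Literature `SpeciesScheme.HasCSClustering r (canon r sch) Δ₁` (Cauchy–Schwarz clustering of the canonical scheme's
lattice Schwinger functions on FINITE FAMILIES of slab-ordered real factor data, with `ε`-slack, eventually in `k`).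
`stub_cltOfCscl` derives its per-pair shadow (CL-t): for every pair of time-ordered complex test functions `F, G'` a
constant `C(F, G')` with `‖LS_k(ΘF* ⊗ T_t G') − LS_k(ΘF*) LS_k(G')‖ ≤ C e^{−Δ₁t}` eventually in `k`, every `t ≥ 0`.

Proof. (i) `LS = curvDistribution r sch =: 𝓓` (landed `lsk_eq_curvDistribution`); on real product tensors `𝓓` is the
canonical `latticeSchwinger` on the all-curvature string (`curvDistribution_tensor`, `latticeSchwinger_canon_curv`), so
the sesquilinear expansion (`curvCLM`) turns (CSCL) into the slackened Cauchy–Schwarz bound for `(P, Q)` in the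
`ℂ`-spans of `slabOrderedProducts` (`clustersCS_sum`, `clustersCS_span`). (ii) (UUVB) gives ONE threshold `k₀` with
`‖𝓓 k p H‖ ≤ K_p |H|_{p s}` for all `k ≥ k₀`, `p`, off-diagonal `H` (`Transl.norm_curvDistribution_le_of_uuvb`).
(iii) `n, m ≥ 1` (`clt_main`): density (`IsTimeOrdered.mem_closure_span_slabOrderedProducts`) + the k-uniform
continuity (ii), with `ε := e^{−Δ₁t}`. (iv) `n = 0` (`clt_zero_left`): the truncated quantity is
`(ΘF*)(pt) · (𝓓ₘ(T_t G') − 𝓓ₘ(G')) → 0` by the translation half of E1 (route ParabolicTrajectory's landed `stub_transl`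
from (PVG) ∧ (UUVB)); `m = 0` (`clt_zero_right`): it vanishes identically (`curvDistribution_reindex`). (v) `H` is unique
(`eq_appendTensor_of_isAppendTensorOf`). Precedents (continuum side): Literature `MassGapFromLattice/SpanClustering`. [folklore]
-/

noncomputable section

namespace Summit.QuantumFields.YangMills.Theorems.ContinuumLegGivenGap

open scoped SchwartzMap ComplexConjugate
open Filter Topology MeasureTheory
open Literature.MathematicalPhysics.QuantumFieldTheory Literature.MathematicalPhysics.QuantumLattice
  Literature.MathematicalPhysics.AQFT Literature.Probability.LatticeModels
open Summit.QuantumFields.YangMills.Cruxes.ContinuumLimitOnTrajectory.TwoOrbitSynchronisation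
  (curvDistribution curvNPoint canon curvCLM curvCLM_apply curvDistribution_tensor curvDistribution_sub
   curvDistribution_zero curvDistribution_eq_sum latticeSchwinger_canon_curv UUVB PolyVolumeGrowth PlaqIdx stub_transl)
open Summit.QuantumFields.YangMills.Cruxes.ContinuumLimitOnTrajectory.TwoOrbitSynchronisation.Transl
  (norm_curvDistribution_le_of_uuvb)
open Summit.QuantumFields.YangMills.Cruxes.LatticeGapOnTrajectory.OrbitKantorovichFiniteSize.Transfer
  (eq_appendTensor_of_isAppendTensorOf isTensorOf_osAdjoint_appendTensor_translateMulti)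

section Helpers

variable {G : Type} [Group G] [TopologicalSpace G] [IsTopologicalGroup G] [CompactSpace G]
  [MeasurableSpace G] [BorelSpace G] (r : LatticeRep G) (sch : SpeciesScheme (YMSpecies G))

/-! ## §1 Kinematics -/

/-- The `ℂ`-span of the slab-ordered real product tensors consists of time-ordered test functions
(time-ordering is a support condition, stable under sums and scalar multiples). [folklore] -/
theorem isTimeOrdered_of_mem_span {n : ℕ} {F : 𝓢((Fin n → EuclideanSpace ℝ (Fin 4)), ℂ)}
    (hF : F ∈ Submodule.span ℂ (slabOrderedProducts 4 n)) : IsTimeOrdered F := by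
  induction hF using Submodule.span_induction with
  | mem P hP => exact IsTimeOrdered.of_mem_slabOrderedProducts hP
  | zero => intro x hx; rw [FunLike.coe_zero, tsupport_zero] at hx; exact hx.elim
  | add P Q _ _ hP hQ =>
    exact fun x hx => (tsupport_add (P : (Fin n → EuclideanSpace ℝ (Fin 4)) → ℂ) Q hx).elim (fun h => hP h)
      fun h => hQ h
  | smul c P _ hP =>
    exact fun x hx => hP (tsupport_smul_subset_right (fun _ => c) (P : (Fin n → EuclideanSpace ℝ (Fin 4)) → ℂ) hx)

/-- **Reindexing the variables** of a test function along an equivalence `e : Fin p' ≃ Fin p` (with a scalar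
factor) passes through `curvDistribution`: relabel the summation variables of the finite lattice sum. [folklore] -/
theorem curvDistribution_reindex (k : ℕ) {p p' : ℕ} (e : Fin p' ≃ Fin p)
    (H : 𝓢((Fin p → EuclideanSpace ℝ (Fin 4)), ℂ)) (Q : 𝓢((Fin p' → EuclideanSpace ℝ (Fin 4)), ℂ)) (c : ℂ)
    (h : ∀ x : Fin p → EuclideanSpace ℝ (Fin 4), H x = c * Q (fun j => x (e j))) :
    curvDistribution r sch k p H = c * curvDistribution r sch k p' Q := by
  rw [curvDistribution_eq_sum, curvDistribution_eq_sum, Finset.mul_sum]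
  refine Fintype.sum_equiv (Equiv.arrowCongr e.symm (Equiv.refl _)) _ _ fun x => ?_
  have hx : (Equiv.arrowCongr e.symm (Equiv.refl _)) x = fun j => x (e j) := by
    funext j; simp [Equiv.arrowCongr_apply]
  rw [hx, h, mul_assoc]
  congr 2
  refine integral_congr_ae (Eventually.of_forall fun U => ?_)
  exact (Fintype.prod_equiv e _ _ fun j => rfl).symm

/-- On a real product tensor with factor data `f`, for any label string that is constantly the curvature species,
the canonical lattice Schwinger function of `canon r sch` is `curvDistribution` (`curvDistribution_tensor` and the
definitional `latticeSchwinger_canon_curv`). [folklore] -/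
theorem latticeSchwinger_canon_eq_curvDistribution (k p : ℕ) (σ : Fin p → YMSpecies G)
    (hσ : ∀ i, σ i = r.curvature) (f : Fin p → 𝓢(EuclideanSpace ℝ (Fin 4), ℝ))
    {F : 𝓢((Fin p → EuclideanSpace ℝ (Fin 4)), ℂ)} (hF : IsTensorOf F fun i => ofRealTest (f i)) :
    ((latticeSchwinger r.ρ (canon r sch) (fun s => s.F) k p σ f : ℝ) : ℂ) = curvDistribution r sch k p F := by
  obtain rfl : σ = fun _ => r.curvature := funext hσ
  rw [curvDistribution_tensor r sch k p hF, latticeSchwinger_canon_curv]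

/-- A label string appended from two constant curvature strings is constantly the curvature species. [folklore] -/
theorem append_const_curvature {n m : ℕ} (l : Fin (n + m)) :
    Fin.append ((fun _ : Fin n => r.curvature) ∘ Fin.rev) (fun _ : Fin m => r.curvature) l = r.curvature := by
  induction l using Fin.addCases with
  | left i => simp
  | right j => simp

/-! ## §2 (CSCL) in `curvDistribution` form -/

/-- **(CSCL) in `curvDistribution` form, for explicit finite families.** For finite families `gᵢ`, `g'ⱼ` of real
product tensors with slab-ordered factor data `pᵢ`, `qⱼ`, coefficients `cᵢ`, `c'ⱼ`, arities `n, m ≥ 1`, `t ≥ 0`,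
`ε > 0`, EVENTUALLY in `k`: `‖𝓓_{n+m}(ΘP* ⊗ T_t Q) − 𝓓ₙ(ΘP*) 𝓓ₘ(Q)‖ ≤ e^{−Δt} √‖𝓓₂ₙ(ΘP* ⊗ P)‖ √‖𝓓₂ₘ(ΘQ* ⊗ Q)‖ + ε`
for `P = ∑ cᵢ gᵢ`, `Q = ∑ c'ⱼ g'ⱼ` (`𝓓 = curvDistribution r sch k`): identify every term of
`SpeciesScheme.HasCSClustering` with a canonical curvature distribution of a real product tensor
(`isTensorOf_osAdjoint_appendTensor_translateMulti`, `IsTensorOf.osAdjoint/appendTensor`) and expand the left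
sides sesquilinearly (`curvCLM`). [folklore] -/
theorem clustersCS_sum {Δ : ℝ} (hCS : SpeciesScheme.HasCSClustering r (canon r sch) Δ) {n m : ℕ} (hn : n ≠ 0)
    (hm : m ≠ 0) {N N' : ℕ} (c : Fin N → ℂ) (c' : Fin N' → ℂ)
    {g : Fin N → 𝓢((Fin n → EuclideanSpace ℝ (Fin 4)), ℂ)} {g' : Fin N' → 𝓢((Fin m → EuclideanSpace ℝ (Fin 4)), ℂ)}
    {p : Fin N → Fin n → 𝓢(EuclideanSpace ℝ (Fin 4), ℝ)} {q : Fin N' → Fin m → 𝓢(EuclideanSpace ℝ (Fin 4), ℝ)}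
    (hpT : ∀ i, IsTensorOf (g i) fun l => ofRealTest (p i l)) (hp : ∀ i, IsSlabOrdered (p i))
    (hqT : ∀ j, IsTensorOf (g' j) fun l => ofRealTest (q j l)) (hq : ∀ j, IsSlabOrdered (q j))
    {t : ℝ} (ht : 0 ≤ t) {ε : ℝ} (hε : 0 < ε) :
    ∀ᶠ k in atTop,
      ‖curvDistribution r sch k (n + m) ((osAdjoint (∑ i, c i • g i)).appendTensor
            (translateMulti (EuclideanSpace.single 0 t) (∑ j, c' j • g' j))) -
          curvDistribution r sch k n (osAdjoint (∑ i, c i • g i)) * curvDistribution r sch k m (∑ j, c' j • g' j)‖ ≤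
        Real.exp (-Δ * t) *
            Real.sqrt ‖curvDistribution r sch k (n + n) ((osAdjoint (∑ i, c i • g i)).appendTensor (∑ i, c i • g i))‖ *
            Real.sqrt ‖curvDistribution r sch k (m + m)
              ((osAdjoint (∑ j, c' j • g' j)).appendTensor (∑ j, c' j • g' j))‖ + ε := by
  filter_upwards [hCS n m hn hm (fun _ => r.curvature) (fun _ => r.curvature) N N' c c' p q hp hq t ht ε hε] with k hk
  -- identification of the lattice Schwinger functions of the expansion with `curvDistribution`
  have key := latticeSchwinger_canon_eq_curvDistribution r sch k
  simp only [fun (i : Fin N) (j : Fin N') => key (n + m) _ (append_const_curvature r) _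
      (isTensorOf_osAdjoint_appendTensor_translateMulti (hpT i) (hqT j) (EuclideanSpace.single 0 t)),
    fun (i : Fin N) => key n ((fun _ : Fin n => r.curvature) ∘ Fin.rev) (fun _ => rfl) _ (hpT i).osAdjoint,
    fun (j : Fin N') => key m (fun _ : Fin m => r.curvature) (fun _ => rfl) _ (hqT j),
    fun (i i' : Fin N) => key (n + n) _ (append_const_curvature r) _
      (by simpa only [append_ofRealTest] using (hpT i).osAdjoint.appendTensor (hpT i')),
    fun (j j' : Fin N') => key (m + m) _ (append_const_curvature r) _
      (by simpa only [append_ofRealTest] using (hqT j).osAdjoint.appendTensor (hqT j'))] at hk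
  -- sesquilinear expansion of the three `curvDistribution` quantities
  simp only [← curvCLM_apply] at hk ⊢
  rw [map_sum (translateMulti (EuclideanSpace.single (0 : Fin 4) t)),
    Finset.sum_congr rfl fun j _ => map_smul (translateMulti (EuclideanSpace.single (0 : Fin 4) t)) _ _]
  simp only [apply_osAdjoint_appendTensor_sum_smul, apply_osAdjoint_sum_smul, apply_sum_smul]
  convert hk using 3
  rw [Finset.sum_mul_sum, ← Finset.sum_sub_distrib]
  refine Finset.sum_congr rfl fun i _ => ?_
  rw [← Finset.sum_sub_distrib]
  exact Finset.sum_congr rfl fun j _ => by ring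

/-- **(CSCL) on the spans.** For `P`, `Q` in the `ℂ`-spans of the slab-ordered real product tensors (arities
`n, m ≥ 1`), `t ≥ 0` and `ε > 0`, EVENTUALLY in `k`:
`‖𝓓_{n+m}(ΘP* ⊗ T_t Q) − 𝓓ₙ(ΘP*) 𝓓ₘ(Q)‖ ≤ e^{−Δt} √‖𝓓₂ₙ(ΘP* ⊗ P)‖ √‖𝓓₂ₘ(ΘQ* ⊗ Q)‖ + ε` (`Submodule.mem_span_set'`,
`exists_isSlabOrdered_of_mem_slabOrderedProducts`, `clustersCS_sum`). [folklore] -/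
theorem clustersCS_span {Δ : ℝ} (hCS : SpeciesScheme.HasCSClustering r (canon r sch) Δ) {n m : ℕ} (hn : n ≠ 0)
    (hm : m ≠ 0) {P : 𝓢((Fin n → EuclideanSpace ℝ (Fin 4)), ℂ)} {Q : 𝓢((Fin m → EuclideanSpace ℝ (Fin 4)), ℂ)}
    (hP : P ∈ Submodule.span ℂ (slabOrderedProducts 4 n)) (hQ : Q ∈ Submodule.span ℂ (slabOrderedProducts 4 m))
    {t : ℝ} (ht : 0 ≤ t) {ε : ℝ} (hε : 0 < ε) :
    ∀ᶠ k in atTop,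
      ‖curvDistribution r sch k (n + m) ((osAdjoint P).appendTensor (translateMulti (EuclideanSpace.single 0 t) Q)) -
          curvDistribution r sch k n (osAdjoint P) * curvDistribution r sch k m Q‖ ≤
        Real.exp (-Δ * t) * Real.sqrt ‖curvDistribution r sch k (n + n) ((osAdjoint P).appendTensor P)‖ *
          Real.sqrt ‖curvDistribution r sch k (m + m) ((osAdjoint Q).appendTensor Q)‖ + ε := by
  obtain ⟨N, c, g, rfl⟩ := Submodule.mem_span_set'.1 hP
  obtain ⟨N', c', g', rfl⟩ := Submodule.mem_span_set'.1 hQ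
  choose p hpT hp using fun i => exists_isSlabOrdered_of_mem_slabOrderedProducts (g i).2
  choose q hqT hq using fun j => exists_isSlabOrdered_of_mem_slabOrderedProducts (g' j).2
  exact clustersCS_sum r sch hCS hn hm c c' hpT hp hqT hq ht hε

/-! ## §3 The k-uniform estimate for positive arities -/

/-- The Schwartz norm of the zero test function vanishes. [folklore] -/
theorem schwartzNorm_zero_aux {X : Type*} [NormedAddCommGroup X] [NormedSpace ℝ X] (M : ℕ) :
    schwartzNorm M (0 : 𝓢(X, ℂ)) = 0 :=
  map_zero _

/-- **(CL-t) for arities `n, m ≥ 1` from (CSCL) and a k-UNIFORM E0′ bound** `‖𝓓 k p H‖ ≤ K p · |H|_{p s}` on `⁰𝒮`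
beyond ONE threshold in `k`: for time-ordered `F`, `G'` there is `C` with `‖𝓓_{n+m}(ΘF* ⊗ T_t G') − 𝓓ₙ(ΘF*) 𝓓ₘ(G')‖
≤ C e^{−Δt}` eventually in `k`, every `t ≥ 0`. For each `t` choose `(P, Q)` in span × span (ordered-wedge density
`IsTimeOrdered.mem_closure_span_slabOrderedProducts`) in the open set where the k-uniform replacement error is
`< e^{−Δt}` and the Cauchy–Schwarz majorants are below their values at `(F, G')` plus one (continuity of
`(P, Q) ↦ ΘP* ⊗ T_t Q`, of `osAdjoint`, of the Schwartz norms); apply `clustersCS_span` with `ε := e^{−Δt}`. [folklore] -/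
theorem clt_main {Δ : ℝ} (hCS : SpeciesScheme.HasCSClustering r (canon r sch) Δ) {K : ℕ → ℝ} {s : ℕ}
    (hK : ∀ p, 0 ≤ K p) (hb : ∀ᶠ k in atTop, ∀ (p : ℕ) (F : 𝓢((Fin p → EuclideanSpace ℝ (Fin 4)), ℂ)),
      IsOffDiagonal F → ‖curvDistribution r sch k p F‖ ≤ K p * schwartzNorm (p * s) F)
    {n m : ℕ} (hn : n ≠ 0) (hm : m ≠ 0) {F : 𝓢((Fin n → EuclideanSpace ℝ (Fin 4)), ℂ)}
    {G' : 𝓢((Fin m → EuclideanSpace ℝ (Fin 4)), ℂ)} (hF : IsTimeOrdered F) (hG : IsTimeOrdered G') :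
    ∃ C : ℝ, ∀ t : ℝ, 0 ≤ t → ∀ᶠ k in atTop,
      ‖curvDistribution r sch k (n + m) ((osAdjoint F).appendTensor (translateMulti (EuclideanSpace.single 0 t) G')) -
          curvDistribution r sch k n (osAdjoint F) * curvDistribution r sch k m G'‖ ≤ C * Real.exp (-Δ * t) := by
  -- a-priori Cauchy–Schwarz bounds at `(F, G')`, with a `+1` margin
  set A₀ : ℝ := Real.sqrt (K (n + n) * schwartzNorm ((n + n) * s) ((osAdjoint F).appendTensor F)) + 1
  set B₀ : ℝ := Real.sqrt (K (m + m) * schwartzNorm ((m + m) * s) ((osAdjoint G').appendTensor G')) + 1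
  obtain ⟨hA₀pos, hB₀pos⟩ : 0 < A₀ ∧ 0 < B₀ := ⟨by positivity, by positivity⟩
  refine ⟨A₀ * B₀ + 2, fun t ht => ?_⟩
  have hexp : 0 < Real.exp (-Δ * t) := Real.exp_pos _
  set a : EuclideanSpace ℝ (Fin 4) := EuclideanSpace.single 0 t
  -- the k-independent error functional and the Cauchy–Schwarz majorants
  let err : 𝓢((Fin n → EuclideanSpace ℝ (Fin 4)), ℂ) × 𝓢((Fin m → EuclideanSpace ℝ (Fin 4)), ℂ) → ℝ := fun PQ =>
    K (n + m) * schwartzNorm ((n + m) * s)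
        ((osAdjoint F).appendTensor (translateMulti a G') - (osAdjoint PQ.1).appendTensor (translateMulti a PQ.2)) +
      K n * schwartzNorm (n * s) (osAdjoint F - osAdjoint PQ.1) * (K m * schwartzNorm (m * s) G') +
      K n * schwartzNorm (n * s) (osAdjoint PQ.1) * (K m * schwartzNorm (m * s) (G' - PQ.2))
  have herr : Continuous err := by
    refine ((continuous_const.mul ((continuous_schwartzNorm _).comp ?_)).add
      (((continuous_const.mul ((continuous_schwartzNorm _).comp ?_)).mul continuous_const))).add
      ((continuous_const.mul ((continuous_schwartzNorm _).comp ?_)).mul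
        (continuous_const.mul ((continuous_schwartzNorm _).comp ?_)))
    · exact continuous_const.sub (continuous_osAdjoint_appendTensor_translateMulti' a)
    · exact continuous_const.sub (continuous_osAdjoint.comp continuous_fst)
    · exact continuous_osAdjoint.comp continuous_fst
    · exact continuous_const.sub continuous_snd
  let Nr : (l : ℕ) → 𝓢((Fin l → EuclideanSpace ℝ (Fin 4)), ℂ) → ℝ := fun l P =>
    Real.sqrt (K (l + l) * schwartzNorm ((l + l) * s) ((osAdjoint P).appendTensor P))
  have hNr : ∀ l, Continuous (Nr l) := fun l => Real.continuous_sqrt.comp (continuous_const.mul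
    ((continuous_schwartzNorm _).comp (continuous_appendTensor.comp (continuous_osAdjoint.prodMk continuous_id))))
  -- the open neighbourhood of `(F, G')` of good approximants meets span × span
  let U : Set (𝓢((Fin n → EuclideanSpace ℝ (Fin 4)), ℂ) × 𝓢((Fin m → EuclideanSpace ℝ (Fin 4)), ℂ)) :=
    {PQ | err PQ < Real.exp (-Δ * t) ∧ Nr n PQ.1 < A₀ ∧ Nr m PQ.2 < B₀}
  have hU : IsOpen U := (isOpen_lt herr continuous_const).inter ((isOpen_lt ((hNr n).comp continuous_fst)
    continuous_const).inter (isOpen_lt ((hNr m).comp continuous_snd) continuous_const))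
  have hFG : (F, G') ∈ U := by
    refine ⟨?_, lt_add_one _, lt_add_one _⟩
    have h0 : err (F, G') = 0 := by
      simp only [err, sub_self, schwartzNorm_zero_aux, mul_zero, zero_add, zero_mul, mul_zero]
    rw [h0]; exact hexp
  have hcl : (F, G') ∈ closure
      (((Submodule.span ℂ (slabOrderedProducts 4 n) : Set 𝓢((Fin n → EuclideanSpace ℝ (Fin 4)), ℂ)) ×ˢ
        (Submodule.span ℂ (slabOrderedProducts 4 m) : Set 𝓢((Fin m → EuclideanSpace ℝ (Fin 4)), ℂ)))) := by
    rw [closure_prod_eq]; exact ⟨hF.mem_closure_span_slabOrderedProducts, hG.mem_closure_span_slabOrderedProducts⟩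
  obtain ⟨⟨P, Q⟩, ⟨hPQerr, hPA, hQB⟩, hP, hQ⟩ := mem_closure_iff.1 hcl _ hU hFG
  have hPt : IsTimeOrdered P := isTimeOrdered_of_mem_span hP
  have hQt : IsTimeOrdered Q := isTimeOrdered_of_mem_span hQ
  have ht0 : 0 ≤ a 0 := by simpa [a] using ht
  filter_upwards [hb, clustersCS_span r sch hCS hn hm hP hQ ht hexp] with k hk hkCS
  -- the k-uniform bounds
  set D := curvDistribution r sch k
  have h1 : ‖D (n + m) ((osAdjoint F).appendTensor (translateMulti a G')) -
      D (n + m) ((osAdjoint P).appendTensor (translateMulti a Q))‖ ≤ K (n + m) * schwartzNorm ((n + m) * s)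
        ((osAdjoint F).appendTensor (translateMulti a G') - (osAdjoint P).appendTensor (translateMulti a Q)) := by
    rw [← curvDistribution_sub]
    exact hk _ _ ((OSReconstructionNoE1.isOffDiagonal_appendTensor_osAdjoint hF
      (OSReconstructionNoE1.isTimeOrdered_translateMulti hG ht0)).sub
        (OSReconstructionNoE1.isOffDiagonal_appendTensor_osAdjoint hPt
          (OSReconstructionNoE1.isTimeOrdered_translateMulti hQt ht0)))
  have h2 : ‖D n (osAdjoint F) - D n (osAdjoint P)‖ ≤ K n * schwartzNorm (n * s) (osAdjoint F - osAdjoint P) := by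
    rw [← curvDistribution_sub]
    exact hk _ _ (hF.isOffDiagonal.osAdjoint.sub hPt.isOffDiagonal.osAdjoint)
  have h5 : ‖D m G' - D m Q‖ ≤ K m * schwartzNorm (m * s) (G' - Q) := by
    rw [← curvDistribution_sub]
    exact hk _ _ (hG.isOffDiagonal.sub hQt.isOffDiagonal)
  have hsP : Real.sqrt ‖D (n + n) ((osAdjoint P).appendTensor P)‖ ≤ A₀ :=
    (Real.sqrt_le_sqrt (hk _ _ (OSReconstructionNoE1.isOffDiagonal_appendTensor_osAdjoint hPt hPt))).trans hPA.le
  have hsQ : Real.sqrt ‖D (m + m) ((osAdjoint Q).appendTensor Q)‖ ≤ B₀ :=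
    (Real.sqrt_le_sqrt (hk _ _ (OSReconstructionNoE1.isOffDiagonal_appendTensor_osAdjoint hQt hQt))).trans hQB.le
  -- assembly
  set DX := D (n + m) ((osAdjoint F).appendTensor (translateMulti a G'))
  set DY := D (n + m) ((osAdjoint P).appendTensor (translateMulti a Q))
  set DF := D n (osAdjoint F)
  set DP := D n (osAdjoint P)
  set DG := D m G'
  set DQ := D m Q
  have herrPQ : ‖DX - DY‖ + ‖DF - DP‖ * ‖DG‖ + ‖DP‖ * ‖DG - DQ‖ ≤ err (P, Q) := by
    dsimp only [err]
    refine add_le_add (add_le_add h1 ?_) ?_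
    · exact mul_le_mul h2 (hk _ _ hG.isOffDiagonal) (norm_nonneg _) (mul_nonneg (hK _) (schwartzNorm_nonneg _ _))
    · exact mul_le_mul (hk _ _ hPt.isOffDiagonal.osAdjoint) h5 (norm_nonneg _)
        (mul_nonneg (hK _) (schwartzNorm_nonneg _ _))
  have hkey : ‖DX - DF * DG‖ ≤ ‖DY - DP * DQ‖ + (‖DX - DY‖ + ‖DF - DP‖ * ‖DG‖ + ‖DP‖ * ‖DG - DQ‖) := by
    rw [show DX - DF * DG = (DY - DP * DQ) + ((DX - DY) - ((DF - DP) * DG + DP * (DG - DQ))) by ring, ← norm_mul,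
      ← norm_mul, add_assoc ‖DX - DY‖]
    exact (norm_add_le _ _).trans (by gcongr; exact (norm_sub_le _ _).trans (by gcongr; exact norm_add_le _ _))
  calc ‖DX - DF * DG‖ ≤ (Real.exp (-Δ * t) * A₀ * B₀ + Real.exp (-Δ * t)) + Real.exp (-Δ * t) := by
        refine hkey.trans (add_le_add (hkCS.trans ?_) (herrPQ.trans hPQerr.le)); gcongr
    _ = (A₀ * B₀ + 2) * Real.exp (-Δ * t) := by ring

/-! ## §4 Degenerate arities -/

/-- **Arity `n = 0`**: the truncated quantity is `(ΘF*)(pt) · (𝓓ₘ(T_t G') − 𝓓ₘ(G'))` (`curvDistribution_reindex`,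
`curvDistribution_zero`), eventually below any `c > 0` by the translation half of E1 (`stub_transl`). [folklore] -/
theorem clt_zero_left (hvol : PolyVolumeGrowth sch) (hU : UUVB r sch) {m : ℕ}
    (F : 𝓢((Fin 0 → EuclideanSpace ℝ (Fin 4)), ℂ)) {G' : 𝓢((Fin m → EuclideanSpace ℝ (Fin 4)), ℂ)}
    (hG : IsOffDiagonal G') (t : ℝ) {c : ℝ} (hc : 0 < c) :
    ∀ᶠ k in atTop,
      ‖curvDistribution r sch k (0 + m) ((osAdjoint F).appendTensor (translateMulti (EuclideanSpace.single 0 t) G')) -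
        curvDistribution r sch k 0 (osAdjoint F) * curvDistribution r sch k m G'‖ ≤ c := by
  have hx : ∀ x : Fin (0 + m) → EuclideanSpace ℝ (Fin 4),
      ((osAdjoint F).appendTensor (translateMulti (EuclideanSpace.single 0 t) G')) x = osAdjoint F default *
        (translateMulti (EuclideanSpace.single 0 t) G') (fun j => x (finCongr (Nat.zero_add m).symm j)) := by
    intro x
    rw [SchwartzMap.appendTensor_apply]
    congr 1
    · exact congrArg _ (Subsingleton.elim _ _)
    · exact congrArg _ (funext fun j => congrArg x (Fin.ext (by simp)))
  have h2 := (tendsto_const_nhds (x := ‖osAdjoint F default‖)).mul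
    (stub_transl G r sch hvol hU m G' hG (EuclideanSpace.single 0 t)).norm
  rw [norm_zero, mul_zero] at h2
  filter_upwards [h2.eventually_lt_const hc] with k hk
  rw [curvDistribution_reindex r sch k (finCongr (Nat.zero_add m).symm) _ _ _ hx, curvDistribution_zero, ← mul_sub,
    norm_mul]
  exact hk.le

/-- **Arity `m = 0`**: the truncated quantity vanishes identically (`curvDistribution_reindex`, `curvDistribution_zero`,
`translateMulti_of_isEmpty`). [folklore] -/
theorem clt_zero_right (k : ℕ) {n : ℕ} (F : 𝓢((Fin n → EuclideanSpace ℝ (Fin 4)), ℂ))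
    (G' : 𝓢((Fin 0 → EuclideanSpace ℝ (Fin 4)), ℂ)) (t : ℝ) :
    curvDistribution r sch k (n + 0) ((osAdjoint F).appendTensor (translateMulti (EuclideanSpace.single 0 t) G')) -
      curvDistribution r sch k n (osAdjoint F) * curvDistribution r sch k 0 G' = 0 := by
  have hx : ∀ x : Fin (n + 0) → EuclideanSpace ℝ (Fin 4),
      ((osAdjoint F).appendTensor (translateMulti (EuclideanSpace.single 0 t) G')) x =
        (translateMulti (EuclideanSpace.single 0 t) G') default *
          osAdjoint F (fun j => x (finCongr (Nat.add_zero n).symm j)) := by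
    intro x
    rw [SchwartzMap.appendTensor_apply, mul_comm]
    congr 1
    exact congrArg _ (Subsingleton.elim _ _)
  rw [curvDistribution_reindex r sch k (finCongr (Nat.add_zero n).symm) _ _ _ hx, curvDistribution_zero,
    translateMulti_of_isEmpty, mul_comm, sub_self]

end Helpers

/-! ## §5 The registered stub -/

/-- `stub_cltOfCscl` — **(CL-t) is the per-pair shadow of (CSCL)** (registered glue stub of stmt-QuantumFields-15828,
line `Sketch`, reshape 14): for a scheme whose renormalised curvature functional `LS` (given by its defining equation)
is canonically normalised (CAN) and exactly centred (VS), with the uniform-threshold plaquette-string bounds (UUVB) and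
polynomial volume growth (PVG), Cauchy–Schwarz clustering of the canonical scheme's lattice Schwinger functions at rate
`Δ₁` (CSCL) implies time-axis exponential clustering at rate `Δ₁` with per-pair constants for all pairs of time-ordered
complex test functions. `LS = curvDistribution r sch` (`lsk_eq_curvDistribution`); the k-uniform bound
`Transl.norm_curvDistribution_le_of_uuvb`; `n, m ≥ 1` by `clt_main`; `n = 0` by `clt_zero_left` (translation half of
E1, `stub_transl`); `m = 0` by `clt_zero_right`; `H` is unique (`eq_appendTensor_of_isAppendTensorOf`). [folklore] -/
theorem stub_cltOfCscl :
    ∀ (G : Type) [Group G] [TopologicalSpace G] [IsTopologicalGroup G] [CompactSpace G]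
      [MeasurableSpace G] [BorelSpace G] (r : LatticeRep G) (sch : SpeciesScheme (YMSpecies G))
      (LS : (k n : ℕ) → SchwartzMap (Fin n → EuclideanSpace ℝ (Fin 4)) ℂ → ℂ),
      (∀ (k n : ℕ) (F : SchwartzMap (Fin n → EuclideanSpace ℝ (Fin 4)) ℂ), LS k n F =
        ∫ U : GaugeConfig 4 (sch.side k) G, ∑ x : Fin n → ↥(box 4 (sch.L k)),
          F (fun i => sch.a k • siteToE ↑(x i)) *
            ∏ i, ((sch.c r.curvature k * sch.a k ^ 4 *
              (r.curvature.F (configShift (-↑(x i)) (torusLift (sch.side k) U)) - sch.m r.curvature k) : ℝ) : ℂ)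
          ∂(wilsonMeasure r.ρ (sch.β k))) →
      (∀ k : ℕ, sch.c r.curvature k = (sch.a k ^ 4)⁻¹) →
      (∀ k : ℕ, sch.m r.curvature k =
        ∫ U : GaugeConfig 4 (sch.side k) G, r.curvature.F (torusLift (sch.side k) U) ∂(wilsonMeasure r.ρ (sch.β k))) →
      (∃ (s : ℕ) (α β' : ℝ), ∀ᶠ k in atTop, ∀ (p : ℕ) (q : Fin p → {q : Fin 4 × Fin 4 // q.1 < q.2})
        (F : SchwartzMap (Fin p → EuclideanSpace ℝ (Fin 4)) ℂ), IsOffDiagonal F →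
        ‖∫ U : GaugeConfig 4 (sch.side k) G, ∑ x : Fin p → ↥(box 4 (sch.L k)),
            F (fun i => sch.a k • siteToE ↑(x i)) *
              ∏ i, ((plaquetteObs r.ρ 0 (q i).1.1 (q i).1.2 (configShift (-↑(x i)) (torusLift (sch.side k) U)) -
                wilsonTorusMean r.ρ (sch.β k) (sch.L k) (plaquetteObs r.ρ 0 (q i).1.1 (q i).1.2) : ℝ) : ℂ)
            ∂(wilsonMeasure r.ρ (sch.β k))‖ ≤ α * (p.factorial : ℝ) ^ β' * schwartzNorm (p * s) F) →
      (∃ N : ℕ, 1 ≤ N ∧ ∀ᶠ k in atTop, (sch.a k)⁻¹ ≤ (sch.a k * (sch.L k : ℝ)) ^ N) →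
      (∃ Δ₁ : ℝ, 0 < Δ₁ ∧ SpeciesScheme.HasCSClustering r
        (Summit.QuantumFields.YangMills.Cruxes.ContinuumLimitOnTrajectory.TwoOrbitSynchronisation.canon r sch) Δ₁) →
      ∃ Δ : ℝ, 0 < Δ ∧ ∀ (n m : ℕ) (F : SchwartzMap (Fin n → EuclideanSpace ℝ (Fin 4)) ℂ)
        (G' : SchwartzMap (Fin m → EuclideanSpace ℝ (Fin 4)) ℂ), IsTimeOrdered F → IsTimeOrdered G' →
        ∃ C : ℝ, ∀ t : ℝ, 0 ≤ t → ∀ᶠ k in atTop,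
          ∀ H : SchwartzMap (Fin (n + m) → EuclideanSpace ℝ (Fin 4)) ℂ,
            IsAppendTensorOf H (osAdjoint F) (translateMulti (EuclideanSpace.single 0 t) G') →
              ‖LS k (n + m) H - LS k n (osAdjoint F) * LS k m G'‖ ≤ C * Real.exp (-Δ * t) := by
  intro G _ _ _ _ _ _ r sch LS hLS hCAN hVS hUUVB hPVG hCS
  obtain ⟨Δ₁, hΔ₁, hCS⟩ := hCS
  have hU : UUVB r sch := uuvb_of_unfolded r sch hUUVB
  obtain ⟨s, α, β, hb⟩ := norm_curvDistribution_le_of_uuvb r sch hU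
  -- the k-uniform E0′ bound with a nonnegative constant
  set K : ℕ → ℝ := fun p => |(Fintype.card PlaqIdx : ℝ) ^ p * (α * (p.factorial : ℝ) ^ β)|
  have hb' : ∀ᶠ k in atTop, ∀ (p : ℕ) (F : 𝓢((Fin p → EuclideanSpace ℝ (Fin 4)), ℂ)), IsOffDiagonal F →
      ‖curvDistribution r sch k p F‖ ≤ K p * schwartzNorm (p * s) F := by
    refine hb.mono fun k hk p F hF => (hk p F hF).trans ?_
    rw [← mul_assoc]
    exact mul_le_mul_of_nonneg_right (le_abs_self _) (schwartzNorm_nonneg _ _)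
  have hLS' : ∀ (k n : ℕ) (F : 𝓢((Fin n → EuclideanSpace ℝ (Fin 4)), ℂ)), LS k n F = curvDistribution r sch k n F :=
    lsk_eq_curvDistribution r sch LS hLS hCAN hVS
  refine ⟨Δ₁, hΔ₁, fun n m F G' hF hG' => ?_⟩
  rcases Nat.eq_zero_or_pos n with rfl | hn
  · -- `n = 0`: translation non-invariance of `𝓓ₘ`, killed by the translation half of E1
    refine ⟨1, fun t ht => ?_⟩
    have hpos : 0 < 1 * Real.exp (-Δ₁ * t) := by positivity
    filter_upwards [clt_zero_left r sch hPVG hU F hG'.isOffDiagonal t hpos] with k hk H hH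
    simpa only [eq_appendTensor_of_isAppendTensorOf hH, hLS'] using hk
  rcases Nat.eq_zero_or_pos m with rfl | hm
  · -- `m = 0`: the truncated quantity vanishes identically
    refine ⟨0, fun t ht => Eventually.of_forall fun k H hH => ?_⟩
    rw [eq_appendTensor_of_isAppendTensorOf hH, hLS', hLS', hLS', clt_zero_right, norm_zero, zero_mul]
  · obtain ⟨C, hC⟩ := clt_main r sch hCS (fun p => abs_nonneg _) hb' hn.ne' hm.ne' hF hG'
    refine ⟨C, fun t ht => (hC t ht).mono fun k hk H hH => ?_⟩
    rw [eq_appendTensor_of_isAppendTensorOf hH, hLS', hLS', hLS']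
    exact hk

end Summit.QuantumFields.YangMills.Theorems.ContinuumLegGivenGap

end
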